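import Summits.ResolutionOfSingularities.ResolutionOfSingularities.Theorems.EquisingularLiftEquisingularLiftNatTraceIso
import Summits.ResolutionOfSingularities.ResolutionOfSingularities.Theorems.EquisingularLiftEquisingularLiftNatUsefulTouch
import Summits.ResolutionOfSingularities.ResolutionOfSingularities.Theorems.EquisingularLiftEquisingularLiftSplit
import HarnessLib

/-!
# [OURS · L1 W4.5(b) · EL♮] T-USEFUL-TOUCH-NP: EL♮ ⇒ a useful touch whose TRACE at the non-regular touching point is
# NOT PRINCIPAL — any `n`
# (crux `EquisingularLiftNat` = stmt-ResolutionOfSingularities-20038; K-∀n / K5-BMY necessity lane, kill test #50)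

HONEST FRAMING. OURS (cell res-hironaka, crux chain w45b, slot W4.5(b)); NOT a statement of any manuscript; replaces the role
of NOTHING in the manuscript; AI-written, AI review is weaker than expert review. Helper `--supports
stmt-ResolutionOfSingularities-20038 --as helper`.

WHAT. T-USEFUL-TOUCH (p513560) produces, from a successful horizontal chain, a stage `(X₁, σ₁, Y₁)`, a NON-REGULAR point `w` of
`V(closure Y₁)` over `x`, and an admissible centre `C ∋ x₁` whose blow-up leaves every point over `x` regular. T-TRACE-ISO
(p518228, `not_isPrincipal_trace_of_usefulTouch`) says such a touch has NON-PRINCIPAL TRACE `(C·𝒪_{V(closure Y₁)})_w` provided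
`closure Y₁` is irreducible and not inside `supp C`. This file discharges those two provisos from the CHAIN itself: the item's chain
predicate (`Split.Chain`, tree `…EquisingularLiftDefs`) is implied by the useful-touch closure (more step hypotheses), and along it
the strict transform of `Y = closure {ξ}` is `closure {ξ₁}` with `σ₁⁻¹{ξ} = {ξ₁}` (`Split.Chain.fibre`, p-tree): irreducible, and
meeting `supp C` only off `ξ₁` because the centres lie off the generic point of `Y`.

* `chain_of_horizChain` — the useful-touch (horizontal E1) closure implies the item's `Split.Chain`;
* `isIrreducible_closure_and_not_subset_of_horizChain` — hence `closure Y₁` is irreducible and `closure Y₁ ⊄ supp C` for every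
  admissible `C`;
* `exists_useful_touch_nonprincipal_of_natChain` — general base: the useful touch of p513560 WITH `IsIrreducible (closure Y₁)`,
  `¬ closure Y₁ ⊆ supp C` and `¬ (C·𝒪_{V(closure Y₁)})_w` principal;
* `usefulTouchNonprincipal_of_equisingularLiftNat` — THE OBJECT in the item's currency (`ℙⁿ_O`, binders of `ULTFlat` p512565);
* `not_equisingularLiftNat_of_forall_touch_principal_trace` — THE DISPROVER'S EXIT: to refute EL♮ at an instance `(k, n, H, ι, h)`
  it suffices to show, for every `(O, π)` and some `φ, Y`, that EVERY admissible touch through a non-regular point over `x` that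
  finishes the resolution over `x` has PRINCIPAL trace there (for fat touches this is `…AnisoInertia.fatTouchInert`, p515200, via
  the ring bridge `isPrincipal_stalkIdeal_comap_of_map_mk`, p518228).

References: tree `…NatUsefulTouch` (p513560), `…NatTraceIso` (p518228), `…EquisingularLiftSplit` (`Split.Chain.fibre`),
`…EquisingularLiftDefs` (`Split.Chain`).
-/

set_option linter.dupNamespace false -- mandated namespace `Summit.<Summit>.<Problem>` of this single-conjunct summit
set_option linter.overlappingInstances false -- item signatures carry `[IsDomain O] [IsDiscreteValuationRing O]`

open CategoryTheory AlgebraicGeometry TopologicalSpace Topology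
open Literature.AlgebraicGeometry.Resolution
open AlgebraicGeometry.Scheme.IdealSheafData
open Summit.ResolutionOfSingularities.ResolutionOfSingularities.Theses.EquisingularLift.Split
open Summit.ResolutionOfSingularities.ResolutionOfSingularities.Cruxes.EquisingularLift.StrataSplit
open Summit.ResolutionOfSingularities.ResolutionOfSingularities.Theorems.EquisingularLift

namespace Summit.ResolutionOfSingularities.ResolutionOfSingularities.Cruxes.EquisingularLiftNat.Sections

/-! ## The horizontal E1-closure lies in the item's `Split.Chain` -/

/-- A stage of the HORIZONTAL E1-closure (steps: blow-up, regular centre, `O`-flat centre, off the generic points of `Y`, E1) is a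
stage of the item's chain `Split.Chain` (steps: blow-up, regular centre, off the generic points of `Y`): a closure under MORE step
hypotheses lies in the closure under fewer. [folklore] -/
theorem chain_of_horizChain {O : Type} [CommRing O] [IsLocalRing O] {P : AlgebraicGeometry.Scheme.{0}} (q : P ⟶ AlgebraicGeometry.Spec (.of O))
    (Y : Set P) {X₁ : AlgebraicGeometry.Scheme.{0}} {σ₁ : X₁ ⟶ P} {Y₁ : Set X₁}
    (hhr : (∀ Q : (∀ X' : AlgebraicGeometry.Scheme.{0}, (X' ⟶ P) → Set X' → Prop), Q P (CategoryTheory.CategoryStruct.id _) Y → (∀ (X' X'' : AlgebraicGeometry.Scheme.{0}) (σ' : X' ⟶ P) (Y' : Set X') (C : X'.IdealSheafData) (τ : X'' ⟶ X'), Q X' σ' Y' → Literature.AlgebraicGeometry.Resolution.IsBlowup τ C → Literature.AlgebraicGeometry.Resolution.Scheme.IsRegular C.subscheme → AlgebraicGeometry.Flat (CategoryTheory.CategoryStruct.comp C.subschemeι (CategoryTheory.CategoryStruct.comp σ' q)) → σ' '' (C.support : Set X') ⊆ {x | ¬ IsGenericPoint x Y} → (C.support : Set X') ∩ (CategoryTheory.CategoryStruct.comp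 σ' q) ⁻¹' {IsLocalRing.closedPoint O} ⊆ Y' → Q X'' (CategoryTheory.CategoryStruct.comp τ σ') (closure (τ ⁻¹' (Y' \ (C.support : Set X'))))) → Q X₁ σ₁ Y₁)) :
    Chain P Y X₁ σ₁ Y₁ :=
  fun Q h0 hs => hhr Q h0 (fun X' X'' σ' Y' C τ hQ hbl hC _ hg _ => hs X' X'' σ' Y' C τ hQ hbl hC hg)

/-- **Chain invariants the trace analysis consumes.** If `ξ` is a generic point of `Y` and `(X₁, σ₁, Y₁)` is a stage of the
horizontal E1-closure of `(P, 𝟙, Y)`, then `closure Y₁` is IRREDUCIBLE, and for every ideal sheaf `C` on `X₁` whose support maps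
off the generic points of `Y` one has `closure Y₁ ⊄ supp C` (`Split.Chain.fibre`: `Y₁ = closure {ξ₁}` with `σ₁ ξ₁ = ξ`).
[folklore] -/
theorem isIrreducible_closure_and_not_subset_of_horizChain {O : Type} [CommRing O] [IsLocalRing O] {P : AlgebraicGeometry.Scheme.{0}}
    (q : P ⟶ AlgebraicGeometry.Spec (.of O)) (Y : Set P) {ξ : P} (hξ : IsGenericPoint ξ Y)
    {X₁ : AlgebraicGeometry.Scheme.{0}} {σ₁ : X₁ ⟶ P} {Y₁ : Set X₁}
    (hhr : (∀ Q : (∀ X' : AlgebraicGeometry.Scheme.{0}, (X' ⟶ P) → Set X' → Prop), Q P (CategoryTheory.CategoryStruct.id _) Y → (∀ (X' X'' : AlgebraicGeometry.Scheme.{0}) (σ' : X' ⟶ P) (Y' : Set X') (C : X'.IdealSheafData) (τ : X'' ⟶ X'), Q X' σ' Y' → Literature.AlgebraicGeometry.Resolution.IsBlowup τ C → Literature.AlgebraicGeometry.Resolution.Scheme.IsRegular C.subscheme → AlgebraicGeometry.Flat (CategoryTheory.CategoryStruct.comp C.subschemeι (CategoryTheory.CategoryStruct.comp σ' q)) → σ'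 '' (C.support : Set X') ⊆ {x | ¬ IsGenericPoint x Y} → (C.support : Set X') ∩ (CategoryTheory.CategoryStruct.comp σ' q) ⁻¹' {IsLocalRing.closedPoint O} ⊆ Y' → Q X'' (CategoryTheory.CategoryStruct.comp τ σ') (closure (τ ⁻¹' (Y' \ (C.support : Set X'))))) → Q X₁ σ₁ Y₁))
    (C : X₁.IdealSheafData) (hgen : σ₁ '' (C.support : Set X₁) ⊆ {x | ¬ IsGenericPoint x Y}) :
    IsIrreducible (closure Y₁) ∧ ¬ closure Y₁ ⊆ (C.support : Set X₁) := by
  obtain ⟨ξ₁, hfib, hY₁⟩ := Chain.fibre (chain_of_horizChain q Y hhr) hξ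
  have hξ₁ : σ₁ ξ₁ = ξ := by
    have : ξ₁ ∈ σ₁ ⁻¹' {ξ} := by rw [hfib]; exact rfl
    simpa using this
  refine ⟨?_, fun hsub => ?_⟩
  · rw [hY₁, closure_closure]
    exact isIrreducible_singleton.closure
  · have hξ₁C : ξ₁ ∈ (C.support : Set X₁) := hsub (by rw [hY₁, closure_closure]; exact subset_closure rfl)
    exact hgen ⟨ξ₁, hξ₁C, hξ₁⟩ hξ

/-! ## A useful touch with non-principal trace (general base) -/

/-- **A USEFUL TOUCH WITH NON-PRINCIPAL TRACE EXISTS (general base).** Setting of `exists_useful_touch_of_natChain` (p513560) plus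
a generic point `ξ` of `Y`. Then there are a stage `(X₁, σ₁, Y₁)` in the HORIZONTAL E1-closure of `(P, 𝟙, Y)` with `closure Y₁`
irreducible, a point `x₁ ∈ Y₁` over `x`, a point `w` of `V(closure Y₁)` over `x₁` with NON-REGULAR local ring, and an admissible
step `τ : X₂ = Bl_C X₁ → X₁` (`V(C)` regular, `O`-flat, off the generic points of `Y`, E1) with `x₁ ∈ supp C`,
`closure Y₁ ⊄ supp C`, after which EVERY point of `V(closure Y₂)` over `x` is regular — AND THE TRACE `(C·𝒪_{V(closure Y₁)})_w` IS NOT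
A PRINCIPAL IDEAL (`not_isPrincipal_trace_of_usefulTouch`, p518228). [folklore] -/
theorem exists_useful_touch_nonprincipal_of_natChain {O : Type} [CommRing O] [IsDomain O] [IsDiscreteValuationRing O]
    {P : AlgebraicGeometry.Scheme.{0}} [AlgebraicGeometry.IsIntegral P] [AlgebraicGeometry.IsLocallyNoetherian P]
    [CompactSpace P] (q : P ⟶ AlgebraicGeometry.Spec (.of O)) (Y : Set P) {P' : AlgebraicGeometry.Scheme.{0}}
    (σ : P' ⟶ P) (S' : Set P')
    (hch : (∀ Q : (∀ X' : AlgebraicGeometry.Scheme.{0}, (X' ⟶ P) → Set X' → Prop), Q P (CategoryTheory.CategoryStruct.id _) Y → (∀ (X' X'' : AlgebraicGeometry.Scheme.{0}) (σ' : X' ⟶ P) (Y' : Set X') (C : X'.IdealSheafData) (τ : X'' ⟶ X'), Q X' σ' Y' → Literature.AlgebraicGeometry.Resolution.IsBlowup τ C → Literature.AlgebraicGeometry.Resolution.Scheme.IsRegular C.subscheme → σ' '' (C.support : Set X') ⊆ {x | ¬ IsGenericPoint x Y} → (C.support : Set X') ∩ (CategoryTheory.CategoryStruct.comp σ' q) ⁻¹'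 {IsLocalRing.closedPoint O} ⊆ Y' → Q X'' (CategoryTheory.CategoryStruct.comp τ σ') (closure (τ ⁻¹' (Y' \ (C.support : Set X'))))) → Q P' σ S'))
    (hirr : IsIrreducible ((CategoryTheory.CategoryStruct.comp σ q) ⁻¹' {IsLocalRing.closedPoint O}))
    (hreg : Literature.AlgebraicGeometry.Resolution.Scheme.IsRegular (AlgebraicGeometry.Scheme.IdealSheafData.vanishingIdeal (⟨closure S', isClosed_closure⟩ : TopologicalSpace.Closeds P')).subscheme)
    (hgenP : ∀ ξ : P, IsGenericPoint ξ (Set.univ : Set P) → ξ ∉ q ⁻¹' {IsLocalRing.closedPoint O})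
    (hYF : Y ⊆ q ⁻¹' {IsLocalRing.closedPoint O})
    (hNM : ∀ w : P, (w ∈ q ⁻¹' {IsLocalRing.closedPoint O} ∧ ∀ y ∈ q ⁻¹' {IsLocalRing.closedPoint O}, y ⤳ w → y = w) →
      w ∉ closure Y)
    {ξ : P} (hξ : IsGenericPoint ξ Y)
    {x : P} (hxY : x ∈ Y) (hx : (∃ w : ↥(AlgebraicGeometry.Scheme.IdealSheafData.vanishingIdeal (⟨closure Y, isClosed_closure⟩ : TopologicalSpace.Closeds P)).subscheme, (AlgebraicGeometry.Scheme.IdealSheafData.vanishingIdeal (⟨closure Y, isClosed_closure⟩ : TopologicalSpace.Closeds P)).subschemeι w = x ∧ ¬ IsRegularLocalRing ((AlgebraicGeometry.Scheme.IdealSheafData.vanishingIdeal (⟨closure Y, isClosed_closure⟩ : TopologicalSpace.Closeds P)).subscheme.presheaf.stalk w))) :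
    ∃ (X₁ : AlgebraicGeometry.Scheme.{0}) (σ₁ : X₁ ⟶ P) (Y₁ : Set X₁), (∀ Q : (∀ X' : AlgebraicGeometry.Scheme.{0}, (X' ⟶ P) → Set X' → Prop), Q P (CategoryTheory.CategoryStruct.id _) Y → (∀ (X' X'' : AlgebraicGeometry.Scheme.{0}) (σ' : X' ⟶ P) (Y' : Set X') (C : X'.IdealSheafData) (τ : X'' ⟶ X'), Q X' σ' Y' → Literature.AlgebraicGeometry.Resolution.IsBlowup τ C → Literature.AlgebraicGeometry.Resolution.Scheme.IsRegular C.subscheme → AlgebraicGeometry.Flat (CategoryTheory.CategoryStruct.comp C.subschemeι (CategoryTheory.CategoryStruct.comp σ' q)) → σ' '' (C.support : Set X') ⊆ {x | ¬ IsGenericPoint x Y} → (C.support : Set X') ∩ (CategoryTheory.CategoryStruct.comp σ' q) ⁻¹' {IsLocalRing.closedPoint O} ⊆ Y' → Q X'' (CategoryTheory.CategoryStruct.comp τ σ') (closure (τ ⁻¹' (Y' \ (C.support : Set X'))))) → Q X₁ σ₁ Y₁) ∧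
      IsIrreducible (closure Y₁) ∧
      ∃ (x₁ : X₁) (w : ↥(AlgebraicGeometry.Scheme.IdealSheafData.vanishingIdeal (⟨closure Y₁, isClosed_closure⟩ : TopologicalSpace.Closeds X₁)).subscheme) (C : X₁.IdealSheafData) (X₂ : AlgebraicGeometry.Scheme.{0}) (τ : X₂ ⟶ X₁),
        x₁ ∈ Y₁ ∧ σ₁ x₁ = x ∧
        (AlgebraicGeometry.Scheme.IdealSheafData.vanishingIdeal (⟨closure Y₁, isClosed_closure⟩ : TopologicalSpace.Closeds X₁)).subschemeι w = x₁ ∧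
        ¬ IsRegularLocalRing ((AlgebraicGeometry.Scheme.IdealSheafData.vanishingIdeal (⟨closure Y₁, isClosed_closure⟩ : TopologicalSpace.Closeds X₁)).subscheme.presheaf.stalk w) ∧
        Literature.AlgebraicGeometry.Resolution.IsBlowup τ C ∧ Literature.AlgebraicGeometry.Resolution.Scheme.IsRegular C.subscheme ∧
        AlgebraicGeometry.Flat (CategoryTheory.CategoryStruct.comp C.subschemeι (CategoryTheory.CategoryStruct.comp σ₁ q)) ∧
        σ₁ '' (C.support : Set X₁) ⊆ {x | ¬ IsGenericPoint x Y} ∧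
        (C.support : Set X₁) ∩ (CategoryTheory.CategoryStruct.comp σ₁ q) ⁻¹' {IsLocalRing.closedPoint O} ⊆ Y₁ ∧
        x₁ ∈ (C.support : Set X₁) ∧ ¬ closure Y₁ ⊆ (C.support : Set X₁) ∧
        (∀ w' : ↥(AlgebraicGeometry.Scheme.IdealSheafData.vanishingIdeal (⟨closure (closure (τ ⁻¹' (Y₁ \ (C.support : Set X₁)))), isClosed_closure⟩ : TopologicalSpace.Closeds X₂)).subscheme, (CategoryTheory.CategoryStruct.comp τ σ₁) ((AlgebraicGeometry.Scheme.IdealSheafData.vanishingIdeal (⟨closure (closure (τ ⁻¹' (Y₁ \ (C.support : Set X₁)))), isClosed_closure⟩ : TopologicalSpace.Closeds X₂)).subschemeι w') = x → IsRegularLocalRing ((AlgebraicGeometry.Scheme.IdealSheafData.vanishingIdeal (⟨closure (closure (τ ⁻¹' (Y₁ \ (C.support : Set X₁)))), isClosed_closure⟩ : TopologicalSpace.Closeds X₂)).subscheme.presheaf.stalk w')) ∧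
        ¬ (stalkIdeal (C.comap (AlgebraicGeometry.Scheme.IdealSheafData.vanishingIdeal (⟨closure Y₁, isClosed_closure⟩ : TopologicalSpace.Closeds X₁)).subschemeι) w).IsPrincipal := by
  obtain ⟨X₁, σ₁, Y₁, hhr, x₁, hx₁Y, hx₁x, ⟨w, hw, hwreg⟩, C, X₂, τ, hbl, hC, hflat, hgen, hE1, hx₁C, hall⟩ :=
    exists_useful_touch_of_natChain q Y σ S' hch hirr hreg hgenP hYF hNM hxY hx
  obtain ⟨hirr₁, hYC⟩ := isIrreducible_closure_and_not_subset_of_horizChain q Y hξ hhr C hgen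
  haveI : IsLocallyNoetherian X₁ := by
    have key := hhr (fun X' _ _ => IsLocallyNoetherian X') inferInstance ?_
    · exact key
    · intro X' X'' σ' Y' C' τ' hN hbl' _ _ _ _
      haveI := hN
      haveI : IsProper τ' := hbl'.isProper
      exact LocallyOfFiniteType.isLocallyNoetherian τ'
  refine ⟨X₁, σ₁, Y₁, hhr, hirr₁, x₁, w, C, X₂, τ, hx₁Y, hx₁x, hw, hwreg, hbl, hC, hflat, hgen, hE1, hx₁C, hYC, hall, ?_⟩
  exact not_isPrincipal_trace_of_usefulTouch σ₁ x Y₁ C τ hbl hirr₁ hYC w (by rw [hw, hx₁x]) hwreg hall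

/-! ## THE OBJECT: `EquisingularLiftNat p` ⇒ a useful touch with NON-PRINCIPAL trace over every non-regular point -/

/-- **[OURS · L1 W4.5(b)] `EquisingularLiftNat p` ⇒ A USEFUL TOUCH WITH NON-PRINCIPAL TRACE over every non-regular point.** If the
item EL♮ holds at `p`, then for every instance `(k, n, H, ι)`, every point `h` of `H` with non-regular local ring, the `O, π` the
item provides and every `φ, Y`, writing `x := (ι ≫ Proj.map φ) h`: there are a stage `(X₁, σ₁, Y₁)` in the HORIZONTAL E1-closure
of `(ℙⁿ_O, 𝟙, Y)` with `closure Y₁` IRREDUCIBLE, a point `x₁ ∈ Y₁` over `x`, a point `w` of `V(closure Y₁)` over `x₁` with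
NON-REGULAR local ring, and an admissible step `τ : X₂ = Bl_C X₁ → X₁` (`V(C)` regular and `O`-flat, `σ₁(supp C)` off the generic
points of `Y`, E1) with `x₁ ∈ supp C` and `closure Y₁ ⊄ supp C`, after which `V(closure Y₂)` is regular at EVERY point over `x` —
and THE TRACE `(C·𝒪_{V(closure Y₁)})_w` IS NOT A PRINCIPAL IDEAL. Base facts for `ℙⁿ_O` as in `usefulTouch_of_equisingularLiftNat`
(p513560); generic point of `Y` = image of the generic point of the integral `H`. [folklore] -/
theorem usefulTouchNonprincipal_of_equisingularLiftNat {p : ℕ}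
    (hE : Summit.ResolutionOfSingularities.ResolutionOfSingularities.Theorems.EquisingularLiftNat p) :
    p.Prime → ∀ (k : Type) [Field k] [CharP k p] [IsAlgClosed k] (n : ℕ) (H : AlgebraicGeometry.Scheme.{0}) (ι : H ⟶ (Literature.AlgebraicGeometry.Motives.projectiveSpace n k).left), AlgebraicGeometry.IsClosedImmersion ι → AlgebraicGeometry.IsIntegral H → (∀ y : (Literature.AlgebraicGeometry.Motives.projectiveSpace n k).left, ∃ U : (Literature.AlgebraicGeometry.Motives.projectiveSpace n k).left.affineOpens, y ∈ (U : (Literature.AlgebraicGeometry.Motives.projectiveSpace n k).left.Opens) ∧ (ι.ker.ideal U).IsPrincipal) → ∀ (h : H), ¬ IsRegularLocalRing (H.presheaf.stalk h) → ∃ (O : Type) (_ : CommRing O) (_ : IsDomain O) (_ : IsDiscreteValuationRing O) (_ : CharZero O) (π : O →+* k), Function.Surjective π ∧ (letI := MvPolynomial.gradedAlgebra (σ := Fin (n + 1)) (R := O); letI := MvPolynomial.gradedAlgebra (σ := Fin (n + 1)) (R := k); ∀ (φ : MvPolynomial.homogeneousSubmodule (Fin (n + 1)) O →+*ᵍ MvPolynomial.homogeneousSubmodule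 (Fin (n + 1)) k) (hφ' : HomogeneousIdeal.irrelevant (MvPolynomial.homogeneousSubmodule (Fin (n + 1)) k) ≤ (HomogeneousIdeal.irrelevant (MvPolynomial.homogeneousSubmodule (Fin (n + 1)) O)).map φ), (∀ s, φ s = MvPolynomial.map π s) → ∀ Y : Set (AlgebraicGeometry.Proj (MvPolynomial.homogeneousSubmodule (Fin (n + 1)) O)), Y = Set.range (CategoryTheory.CategoryStruct.comp ι (AlgebraicGeometry.Proj.map φ hφ') : H ⟶ (AlgebraicGeometry.Proj (MvPolynomial.homogeneousSubmodule (Fin (n + 1)) O))) → ∃ (X₁ : AlgebraicGeometry.Scheme.{0}) (σ₁ : X₁ ⟶ (AlgebraicGeometry.Proj (MvPolynomial.homogeneousSubmodule (Fin (n + 1)) O))) (Y₁ : Set X₁), (∀ Q : (∀ X' : AlgebraicGeometry.Scheme.{0}, (X' ⟶ (AlgebraicGeometry.Proj (MvPolynomial.homogeneousSubmodule (Fin (n + 1)) O))) → Set X' → Prop), Q (AlgebraicGeometry.Proj (MvPolynomial.homogeneousSubmodule (Fin (n + 1)) O)) (CategoryTheory.CategoryStruct.id _) Y → (∀ (X'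 X'' : AlgebraicGeometry.Scheme.{0}) (σ' : X' ⟶ (AlgebraicGeometry.Proj (MvPolynomial.homogeneousSubmodule (Fin (n + 1)) O))) (Y' : Set X') (C : X'.IdealSheafData) (τ : X'' ⟶ X'), Q X' σ' Y' → Literature.AlgebraicGeometry.Resolution.IsBlowup τ C → Literature.AlgebraicGeometry.Resolution.Scheme.IsRegular C.subscheme → AlgebraicGeometry.Flat (CategoryTheory.CategoryStruct.comp C.subschemeι (CategoryTheory.CategoryStruct.comp σ' (CategoryTheory.CategoryStruct.comp (AlgebraicGeometry.Proj.toSpecZero (MvPolynomial.homogeneousSubmodule (Fin (n + 1)) O)) (AlgebraicGeometry.Spec.map (CommRingCat.ofHom (algebraMap O (MvPolynomial.homogeneousSubmodule (Fin (n + 1)) O 0))))))) → σ' '' (C.support : Set X') ⊆ {x | ¬ IsGenericPoint x Y} → (C.support : Set X') ∩ (CategoryTheory.CategoryStruct.comp σ' (CategoryTheory.CategoryStruct.comp (AlgebraicGeometry.Proj.toSpecZero (MvPolynomial.homogeneousSubmodule (Fin (n + 1)) O)) (AlgebraicGeometry.Spec.map (CommRingCat.ofHom (algebraMap O (MvPolynomial.homogeneousSubmodule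 (Fin (n + 1)) O 0)))))) ⁻¹' {IsLocalRing.closedPoint O} ⊆ Y' → Q X'' (CategoryTheory.CategoryStruct.comp τ σ') (closure (τ ⁻¹' (Y' \ (C.support : Set X'))))) → Q X₁ σ₁ Y₁) ∧ IsIrreducible (closure Y₁) ∧ ∃ (x₁ : X₁) (w : ↥(AlgebraicGeometry.Scheme.IdealSheafData.vanishingIdeal (⟨closure Y₁, isClosed_closure⟩ : TopologicalSpace.Closeds X₁)).subscheme) (C : X₁.IdealSheafData) (X₂ : AlgebraicGeometry.Scheme.{0}) (τ : X₂ ⟶ X₁), x₁ ∈ Y₁ ∧ σ₁ x₁ = ((CategoryTheory.CategoryStruct.comp ι (AlgebraicGeometry.Proj.map φ hφ') : H ⟶ (AlgebraicGeometry.Proj (MvPolynomial.homogeneousSubmodule (Fin (n + 1)) O))) h) ∧ (AlgebraicGeometry.Scheme.IdealSheafData.vanishingIdeal (⟨closure Y₁, isClosed_closure⟩ : TopologicalSpace.Closeds X₁)).subschemeι w = x₁ ∧ ¬ IsRegularLocalRing ((AlgebraicGeometry.Scheme.IdealSheafData.vanishingIdeal (⟨closure Y₁, isClosed_closure⟩ :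 TopologicalSpace.Closeds X₁)).subscheme.presheaf.stalk w) ∧ Literature.AlgebraicGeometry.Resolution.IsBlowup τ C ∧ Literature.AlgebraicGeometry.Resolution.Scheme.IsRegular C.subscheme ∧ AlgebraicGeometry.Flat (CategoryTheory.CategoryStruct.comp C.subschemeι (CategoryTheory.CategoryStruct.comp σ₁ (CategoryTheory.CategoryStruct.comp (AlgebraicGeometry.Proj.toSpecZero (MvPolynomial.homogeneousSubmodule (Fin (n + 1)) O)) (AlgebraicGeometry.Spec.map (CommRingCat.ofHom (algebraMap O (MvPolynomial.homogeneousSubmodule (Fin (n + 1)) O 0))))))) ∧ σ₁ '' (C.support : Set X₁) ⊆ {x | ¬ IsGenericPoint x Y} ∧ (C.support : Set X₁) ∩ (CategoryTheory.CategoryStruct.comp σ₁ (CategoryTheory.CategoryStruct.comp (AlgebraicGeometry.Proj.toSpecZero (MvPolynomial.homogeneousSubmodule (Fin (n + 1)) O)) (AlgebraicGeometry.Spec.map (CommRingCat.ofHom (algebraMap O (MvPolynomial.homogeneousSubmodule (Fin (n + 1)) O 0)))))) ⁻¹' {IsLocalRing.closedPoint O} ⊆ Y₁ ∧ x₁ ∈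 (C.support : Set X₁) ∧ ¬ closure Y₁ ⊆ (C.support : Set X₁) ∧ (∀ w' : ↥(AlgebraicGeometry.Scheme.IdealSheafData.vanishingIdeal (⟨closure (closure (τ ⁻¹' (Y₁ \ (C.support : Set X₁)))), isClosed_closure⟩ : TopologicalSpace.Closeds X₂)).subscheme, (CategoryTheory.CategoryStruct.comp τ σ₁) ((AlgebraicGeometry.Scheme.IdealSheafData.vanishingIdeal (⟨closure (closure (τ ⁻¹' (Y₁ \ (C.support : Set X₁)))), isClosed_closure⟩ : TopologicalSpace.Closeds X₂)).subschemeι w') = ((CategoryTheory.CategoryStruct.comp ι (AlgebraicGeometry.Proj.map φ hφ') : H ⟶ (AlgebraicGeometry.Proj (MvPolynomial.homogeneousSubmodule (Fin (n + 1)) O))) h) → IsRegularLocalRing ((AlgebraicGeometry.Scheme.IdealSheafData.vanishingIdeal (⟨closure (closure (τ ⁻¹' (Y₁ \ (C.support : Set X₁)))), isClosed_closure⟩ : TopologicalSpace.Closeds X₂)).subscheme.presheaf.stalk w')) ∧ ¬ (stalkIdeal (C.comap (AlgebraicGeometry.Scheme.IdealSheafData.vanishingIdeal (⟨closure Y₁,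 isClosed_closure⟩ : TopologicalSpace.Closeds X₁)).subschemeι) w).IsPrincipal) := by
  intro hp k _ _ _ n H ι hι hH hloc h hreg
  obtain ⟨O, i1, i2, i3, i4, π, hπ, h'⟩ := hE hp k n H ι hι hH hloc
  refine ⟨O, i1, i2, i3, i4, π, hπ, ?_⟩
  letI := MvPolynomial.gradedAlgebra (σ := Fin (n + 1)) (R := O)
  letI := MvPolynomial.gradedAlgebra (σ := Fin (n + 1)) (R := k)
  intro φ hφ' hφ Y hY
  haveI := hH
  obtain ⟨P', σ, S', hchain, hirr, hregS⟩ := h' φ hφ' hφ Y hY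
  -- the base `q : ℙⁿ_O → Spec O`
  set q : Proj (MvPolynomial.homogeneousSubmodule (Fin (n + 1)) O) ⟶ Spec (.of O) :=
    Proj.toSpecZero (MvPolynomial.homogeneousSubmodule (Fin (n + 1)) O) ≫
      Spec.map (CommRingCat.ofHom (algebraMap O (MvPolynomial.homogeneousSubmodule (Fin (n + 1)) O 0))) with hq
  obtain ⟨hsm, hprop⟩ := stub_projectiveAmbientSmoothProper O n
  haveI : IsProper q := hprop
  haveI : Smooth q := hsm
  haveI : IsNoetherianRing (CommRingCat.of O) := inferInstanceAs (IsNoetherianRing O)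
  haveI : IsDomain (CommRingCat.of O) := inferInstanceAs (IsDomain O)
  haveI : IsLocallyNoetherian (Proj (MvPolynomial.homogeneousSubmodule (Fin (n + 1)) O)) :=
    LocallyOfFiniteType.isLocallyNoetherian q
  haveI : CompactSpace ↥(Proj (MvPolynomial.homogeneousSubmodule (Fin (n + 1)) O)) :=
    QuasiCompact.compactSpace_of_compactSpace q
  haveI : IsIntegral (Proj (MvPolynomial.homogeneousSubmodule (Fin (n + 1)) O)) :=
    Proj.isIntegral _ (irrelevant_homogeneousSubmodule_ne_bot n O)
  -- the comparison `g : ℙⁿ_k → ℙⁿ_O`, a closed immersion onto the special fibre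
  set g : Proj (MvPolynomial.homogeneousSubmodule (Fin (n + 1)) k) ⟶
      Proj (MvPolynomial.homogeneousSubmodule (Fin (n + 1)) O) := Proj.map φ hφ' with hg
  have hP := ProjectiveAmbientFibre.isPullback_projMap π φ hφ hπ hφ'
  haveI : IsClosedImmersion (Spec.map (CommRingCat.ofHom π)) := IsClosedImmersion.spec_of_surjective _ hπ
  haveI hgci : IsClosedImmersion g := MorphismProperty.IsStableUnderBaseChange.of_isPullback hP.flip inferInstance
  have hpt : ∀ z : Spec (.of k), Spec.map (CommRingCat.ofHom π) z = IsLocalRing.closedPoint O := by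
    intro z
    rw [Spec.map_apply]
    apply PrimeSpectrum.ext
    rw [PrimeSpectrum.comap_asIdeal, CommRingCat.hom_ofHom, Ideal.eq_bot_of_prime z.asIdeal, ← RingHom.ker_eq_comap_bot]
    exact IsLocalRing.eq_maximalIdeal (RingHom.ker_isMaximal_of_surjective π hπ)
  have hgq : ∀ z, q (g z) = IsLocalRing.closedPoint O := fun z ↦
    (Scheme.Hom.comp_apply g q z).symm.trans
      ((congrArg (fun h : Proj (MvPolynomial.homogeneousSubmodule (Fin (n + 1)) k) ⟶ Spec (.of O) ↦ h z) hP.w).trans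
        ((Scheme.Hom.comp_apply _ _ z).trans (hpt _)))
  -- `ι` as a closed immersion into `Proj k[x]`
  let ι' : H ⟶ Proj (MvPolynomial.homogeneousSubmodule (Fin (n + 1)) k) := ι
  haveI : IsClosedImmersion ι' := hι
  have hYF : Y ⊆ q ⁻¹' {IsLocalRing.closedPoint O} := by
    rw [hY]
    rintro _ ⟨a, rfl⟩
    show q ((ι ≫ g) a) = IsLocalRing.closedPoint O
    rw [Scheme.Hom.comp_apply]
    exact hgq (ι a)
  have hYcl : IsClosed Y := by rw [hY]; exact (ι' ≫ g).isClosedEmbedding.isClosed_range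
  -- the generic point of `Y`: image of the generic point of the integral `H`
  have hξ : IsGenericPoint ((ι' ≫ g) (genericPoint H)) Y := by
    have h1 := (genericPoint_spec H).image (ι' ≫ g).base.hom.continuous
    rw [Set.image_univ] at h1
    have h2 : closure (Set.range ⇑(ι' ≫ g)) = Y := by
      have e : Set.range ⇑(ι' ≫ g) = Y := hY.symm
      rw [e]; exact hYcl.closure_eq
    rw [h2] at h1
    exact h1
  -- a point of `ℙⁿ_k` outside `range ι` (else `H ≅ ℙⁿ_k` would be regular at `h`)
  have hH' : ∃ z : Proj (MvPolynomial.homogeneousSubmodule (Fin (n + 1)) k), z ∉ Set.range ι' := by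
    by_contra hall
    push Not at hall
    have hrange : Set.range (𝟙 (Proj (MvPolynomial.homogeneousSubmodule (Fin (n + 1)) k))) = Set.range ι' := by
      ext z; simpa using hall z
    haveI : IsIntegral (Proj (MvPolynomial.homogeneousSubmodule (Fin (n + 1)) k)) :=
      isIntegral_proj_homogeneousSubmodule n k
    have hregP : IsRegularLocalRing ((Proj (MvPolynomial.homogeneousSubmodule (Fin (n + 1)) k)).presheaf.stalk (ι' h)) :=
      isRegular_projectiveSpace n k (ι' h)
    exact hreg ((isRegularLocalRing_stalk_iff_of_range_eq (𝟙 _) ι' hrange (a₁ := ι' h) (a₂ := h) (by simp)).mpr hregP)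
  -- no maximal point of the (irreducible) special fibre lies in `closure Y = Y`
  have hirrP : IsIrreducible (q ⁻¹' {IsLocalRing.closedPoint O}) := by
    haveI := isIntegral_specialFibre_projectiveSpace O n
    exact isIrreducible_preimage_closedPoint O _ q
  have hNM : ∀ w, (w ∈ q ⁻¹' {IsLocalRing.closedPoint O} ∧
      ∀ y ∈ q ⁻¹' {IsLocalRing.closedPoint O}, y ⤳ w → y = w) → w ∉ closure Y := by
    intro w hw hwY
    obtain ⟨ζ, hζ⟩ := QuasiSober.sober hirrP
      ((IsLocalRing.isClosed_singleton_closedPoint O).preimage q.base.hom.continuous)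
    have hζw : ζ = w := hw.2 ζ hζ.mem (hζ.specializes hw.1)
    rw [hYcl.closure_eq] at hwY
    have hFY : q ⁻¹' {IsLocalRing.closedPoint O} ⊆ Y := by
      rw [← hζ.def, hζw]
      exact closure_minimal (Set.singleton_subset_iff.mpr hwY) hYcl
    obtain ⟨z, hz⟩ := hH'
    have hgz : g z ∈ Y := hFY (hgq z)
    rw [hY] at hgz
    obtain ⟨a, ha⟩ := hgz
    rw [Scheme.Hom.comp_apply] at ha
    exact hz ⟨a, g.isClosedEmbedding.injective ha⟩
  -- the generic point of `ℙⁿ_O` is off the special fibre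
  have hgenP : ∀ ξ : Proj (MvPolynomial.homogeneousSubmodule (Fin (n + 1)) O),
      IsGenericPoint ξ (Set.univ : Set (Proj (MvPolynomial.homogeneousSubmodule (Fin (n + 1)) O))) →
        ξ ∉ q ⁻¹' {IsLocalRing.closedPoint O} := by
    intro ξ hξ hξF
    have hopen : IsOpen (Set.range q) := by
      rw [← Set.image_univ]; exact q.isOpenMap _ isOpen_univ
    have hne : (Set.range q).Nonempty := ⟨q ξ, ξ, rfl⟩
    have hgen : genericPoint (Spec (.of O)) ∈ Set.range q := by
      rw [(genericPoint_spec (Spec (.of O))).mem_open_set_iff hopen]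
      simpa using hne
    obtain ⟨p₀, hp₀⟩ := hgen
    have hp₀F : p₀ ∈ q ⁻¹' {IsLocalRing.closedPoint O} := by
      have hF : q ⁻¹' {IsLocalRing.closedPoint O} = Set.univ := by
        apply Set.eq_univ_of_univ_subset
        rw [← hξ.def]
        exact closure_minimal (Set.singleton_subset_iff.mpr hξF)
          ((IsLocalRing.isClosed_singleton_closedPoint O).preimage q.base.hom.continuous)
      rw [hF]; trivial
    have h1 : genericPoint (Spec (.of O)) = IsLocalRing.closedPoint O := hp₀.symm.trans hp₀F
    rw [genericPoint_eq_bot_of_affine] at h1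
    have h2 := congrArg PrimeSpectrum.asIdeal h1
    exact IsDiscreteValuationRing.not_a_field O h2.symm
  -- the non-regular point of `V(closure Y)` over `x := (ι ≫ g) h` (pv-003's bridge)
  have hci := @IsClosedImmersion.comp _ _ _ ι _ hι hgci
  have hx := @exists_vanishingIdeal_witness_of_not_isRegularLocalRing _ _ _ hci inferInstance _ hreg
  subst hY
  exact exists_useful_touch_nonprincipal_of_natChain q _ σ S' hchain hirr hregS hgenP hYF hNM hξ ⟨h, rfl⟩ hx

/-- **THE DISPROVER'S EXIT (non-principal-trace currency).** If for ONE instance `(k, n, H, ι)` and ONE non-regular `h`, for EVERY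
`(O, π)` some `φ, Y` admit NO useful touch with non-principal trace over `x` — e.g. because every admissible centre through a
non-regular point over `x` whose blow-up finishes the resolution over `x` has PRINCIPAL trace there (fat touches:
`…AnisoInertia.fatTouchInert` p515200 via `isPrincipal_stalkIdeal_comap_of_map_mk` p518228) — then `EquisingularLiftNat p` fails.
[folklore] -/
theorem not_equisingularLiftNat_of_no_usefulTouchNonprincipal {p : ℕ}
    (hno : ¬ (p.Prime → ∀ (k : Type) [Field k] [CharP k p] [IsAlgClosed k] (n : ℕ) (H : AlgebraicGeometry.Scheme.{0}) (ι : H ⟶ (Literature.AlgebraicGeometry.Motives.projectiveSpace n k).left), AlgebraicGeometry.IsClosedImmersion ι → AlgebraicGeometry.IsIntegral H → (∀ y : (Literature.AlgebraicGeometry.Motives.projectiveSpace n k).left, ∃ U : (Literature.AlgebraicGeometry.Motives.projectiveSpace n k).left.affineOpens, y ∈ (U : (Literature.AlgebraicGeometry.Motives.projectiveSpace n k).left.Opens) ∧ (ι.ker.ideal U).IsPrincipal) → ∀ (h : H), ¬ IsRegularLocalRing (H.presheaf.stalk h) → ∃ (O : Type) (_ : CommRing O) (_ : IsDomain O) (_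 : IsDiscreteValuationRing O) (_ : CharZero O) (π : O →+* k), Function.Surjective π ∧ (letI := MvPolynomial.gradedAlgebra (σ := Fin (n + 1)) (R := O); letI := MvPolynomial.gradedAlgebra (σ := Fin (n + 1)) (R := k); ∀ (φ : MvPolynomial.homogeneousSubmodule (Fin (n + 1)) O →+*ᵍ MvPolynomial.homogeneousSubmodule (Fin (n + 1)) k) (hφ' : HomogeneousIdeal.irrelevant (MvPolynomial.homogeneousSubmodule (Fin (n + 1)) k) ≤ (HomogeneousIdeal.irrelevant (MvPolynomial.homogeneousSubmodule (Fin (n + 1)) O)).map φ), (∀ s, φ s = MvPolynomial.map π s) → ∀ Y : Set (AlgebraicGeometry.Proj (MvPolynomial.homogeneousSubmodule (Fin (n + 1)) O)), Y = Set.range (CategoryTheory.CategoryStruct.comp ι (AlgebraicGeometry.Proj.map φ hφ') : H ⟶ (AlgebraicGeometry.Proj (MvPolynomial.homogeneousSubmodule (Fin (n + 1)) O))) → ∃ (X₁ : AlgebraicGeometry.Scheme.{0}) (σ₁ : X₁ ⟶ (AlgebraicGeometry.Proj (MvPolynomial.homogeneousSubmodule (Fin (n + 1)) O))) (Y₁ :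 Set X₁), (∀ Q : (∀ X' : AlgebraicGeometry.Scheme.{0}, (X' ⟶ (AlgebraicGeometry.Proj (MvPolynomial.homogeneousSubmodule (Fin (n + 1)) O))) → Set X' → Prop), Q (AlgebraicGeometry.Proj (MvPolynomial.homogeneousSubmodule (Fin (n + 1)) O)) (CategoryTheory.CategoryStruct.id _) Y → (∀ (X' X'' : AlgebraicGeometry.Scheme.{0}) (σ' : X' ⟶ (AlgebraicGeometry.Proj (MvPolynomial.homogeneousSubmodule (Fin (n + 1)) O))) (Y' : Set X') (C : X'.IdealSheafData) (τ : X'' ⟶ X'), Q X' σ' Y' → Literature.AlgebraicGeometry.Resolution.IsBlowup τ C → Literature.AlgebraicGeometry.Resolution.Scheme.IsRegular C.subscheme → AlgebraicGeometry.Flat (CategoryTheory.CategoryStruct.comp C.subschemeι (CategoryTheory.CategoryStruct.comp σ' (CategoryTheory.CategoryStruct.comp (AlgebraicGeometry.Proj.toSpecZero (MvPolynomial.homogeneousSubmodule (Fin (n + 1)) O)) (AlgebraicGeometry.Spec.map (CommRingCat.ofHom (algebraMap O (MvPolynomial.homogeneousSubmodule (Fin (n + 1)) O 0))))))) → σ'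 '' (C.support : Set X') ⊆ {x | ¬ IsGenericPoint x Y} → (C.support : Set X') ∩ (CategoryTheory.CategoryStruct.comp σ' (CategoryTheory.CategoryStruct.comp (AlgebraicGeometry.Proj.toSpecZero (MvPolynomial.homogeneousSubmodule (Fin (n + 1)) O)) (AlgebraicGeometry.Spec.map (CommRingCat.ofHom (algebraMap O (MvPolynomial.homogeneousSubmodule (Fin (n + 1)) O 0)))))) ⁻¹' {IsLocalRing.closedPoint O} ⊆ Y' → Q X'' (CategoryTheory.CategoryStruct.comp τ σ') (closure (τ ⁻¹' (Y' \ (C.support : Set X'))))) → Q X₁ σ₁ Y₁) ∧ IsIrreducible (closure Y₁) ∧ ∃ (x₁ : X₁) (w : ↥(AlgebraicGeometry.Scheme.IdealSheafData.vanishingIdeal (⟨closure Y₁, isClosed_closure⟩ : TopologicalSpace.Closeds X₁)).subscheme) (C : X₁.IdealSheafData) (X₂ : AlgebraicGeometry.Scheme.{0}) (τ : X₂ ⟶ X₁), x₁ ∈ Y₁ ∧ σ₁ x₁ = ((CategoryTheory.CategoryStruct.comp ι (AlgebraicGeometry.Proj.map φ hφ') : H ⟶ (AlgebraicGeometry.Proj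 (MvPolynomial.homogeneousSubmodule (Fin (n + 1)) O))) h) ∧ (AlgebraicGeometry.Scheme.IdealSheafData.vanishingIdeal (⟨closure Y₁, isClosed_closure⟩ : TopologicalSpace.Closeds X₁)).subschemeι w = x₁ ∧ ¬ IsRegularLocalRing ((AlgebraicGeometry.Scheme.IdealSheafData.vanishingIdeal (⟨closure Y₁, isClosed_closure⟩ : TopologicalSpace.Closeds X₁)).subscheme.presheaf.stalk w) ∧ Literature.AlgebraicGeometry.Resolution.IsBlowup τ C ∧ Literature.AlgebraicGeometry.Resolution.Scheme.IsRegular C.subscheme ∧ AlgebraicGeometry.Flat (CategoryTheory.CategoryStruct.comp C.subschemeι (CategoryTheory.CategoryStruct.comp σ₁ (CategoryTheory.CategoryStruct.comp (AlgebraicGeometry.Proj.toSpecZero (MvPolynomial.homogeneousSubmodule (Fin (n + 1)) O)) (AlgebraicGeometry.Spec.map (CommRingCat.ofHom (algebraMap O (MvPolynomial.homogeneousSubmodule (Fin (n + 1)) O 0))))))) ∧ σ₁ '' (C.support : Set X₁) ⊆ {x | ¬ IsGenericPoint x Y} ∧ (C.support : Set X₁) ∩ (CategoryTheory.CategoryStruct.comp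 σ₁ (CategoryTheory.CategoryStruct.comp (AlgebraicGeometry.Proj.toSpecZero (MvPolynomial.homogeneousSubmodule (Fin (n + 1)) O)) (AlgebraicGeometry.Spec.map (CommRingCat.ofHom (algebraMap O (MvPolynomial.homogeneousSubmodule (Fin (n + 1)) O 0)))))) ⁻¹' {IsLocalRing.closedPoint O} ⊆ Y₁ ∧ x₁ ∈ (C.support : Set X₁) ∧ ¬ closure Y₁ ⊆ (C.support : Set X₁) ∧ (∀ w' : ↥(AlgebraicGeometry.Scheme.IdealSheafData.vanishingIdeal (⟨closure (closure (τ ⁻¹' (Y₁ \ (C.support : Set X₁)))), isClosed_closure⟩ : TopologicalSpace.Closeds X₂)).subscheme, (CategoryTheory.CategoryStruct.comp τ σ₁) ((AlgebraicGeometry.Scheme.IdealSheafData.vanishingIdeal (⟨closure (closure (τ ⁻¹' (Y₁ \ (C.support : Set X₁)))), isClosed_closure⟩ : TopologicalSpace.Closeds X₂)).subschemeι w') = ((CategoryTheory.CategoryStruct.comp ι (AlgebraicGeometry.Proj.map φ hφ') : H ⟶ (AlgebraicGeometry.Proj (MvPolynomial.homogeneousSubmodule (Fin (n + 1)) O)))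 h) → IsRegularLocalRing ((AlgebraicGeometry.Scheme.IdealSheafData.vanishingIdeal (⟨closure (closure (τ ⁻¹' (Y₁ \ (C.support : Set X₁)))), isClosed_closure⟩ : TopologicalSpace.Closeds X₂)).subscheme.presheaf.stalk w')) ∧ ¬ (stalkIdeal (C.comap (AlgebraicGeometry.Scheme.IdealSheafData.vanishingIdeal (⟨closure Y₁, isClosed_closure⟩ : TopologicalSpace.Closeds X₁)).subschemeι) w).IsPrincipal))) :
    ¬ Summit.ResolutionOfSingularities.ResolutionOfSingularities.Theorems.EquisingularLiftNat p :=
  fun hE => hno (usefulTouchNonprincipal_of_equisingularLiftNat hE)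

end Summit.ResolutionOfSingularities.ResolutionOfSingularities.Cruxes.EquisingularLiftNat.Sections
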